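import Literature.Barriers.CriticalPhenomena.WeaklySAWSuperGaussian
import Literature.MathematicalPhysics.QuantumLattice.GrassmannCoefficientMap
import Mathlib.MeasureTheory.Measure.Haar.NormedSpace
import HarnessLib

/-!
# Substitutions `F(φ,ψ) ↦ F(u(φ),ψ)` in the boson field of a form; translation invariance of `∫`

Support file for the formalisation of §4.1 of Bauerschmidt–Brydges–Slade, CMP 337 (2015),
arXiv:1403.7422 (the change of variables `φ ↦ (1+z₀)^{1/2}φ` of (ExF), the translation `φ ↦ φ + CJ` of
(4.20), and `θF = F(φ+ξ, ψ+η)` of (4.21) all act on the coefficients of a form): a map `u` of the boson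
field acts on the algebra of forms `𝒩 = SForm Λ` of `WeaklySAWSuperGaussian.lean` through the change of the
coefficient ring `f ↦ f ∘ u` (the tree's `GrassmannAlgebra.coeffMap`).

* `fieldPrecomp u` (`f ↦ f ∘ u` on `0`-forms, a ring endomorphism), `smul_eq_ofFun_mul` (complex scalars
  act through constant `0`-forms), `real_smul_apply`;
* **`substForm u : SForm Λ →+* SForm Λ`** (`F(φ,ψ) ↦ F(u(φ),ψ)`): `substForm_ofFun`, `substForm_psi`,
  `substForm_psiBar`, `substForm_smul`, `substForm_complex_smul`, `substForm_grassmannExp`,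
  `berezin_substForm_apply` (`[F(uφ,ψ)]_{top}(φ) = [F]_{top}(uφ)`);
* **`superIntegral_substForm_const_add`**: `∫ F(h+φ, ψ) = ∫ F(φ, ψ)` — translation invariance of the
  super-integral (Lebesgue measure on `ℂ^Λ`; "this translation of `φ` leaves `ψ` unchanged").

Everything is proved; no named facts.
-/

noncomputable section

open MeasureTheory Filter Topology Set Complex ComplexConjugate
open Literature.MathematicalPhysics.QuantumLattice
open Literature.MathematicalPhysics.QuantumLattice.GrassmannAlgebra (berezin gen coeffMap)
open scoped BigOperators

namespace Literature.Barriers.CriticalPhenomena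

namespace CTWSAW

/-! ### Substitutions in the boson field -/

section Subst

variable {Λ : Type*}

/-- Precomposition of `0`-forms with a map `u` of the boson field: `(fieldPrecomp u f)(φ) = f(u φ)`, a ring
endomorphism of the coefficient ring. [folklore] -/
def fieldPrecomp (u : (Λ → ℂ) → (Λ → ℂ)) : FieldFun Λ →+* FieldFun Λ where
  toFun f := fun φ => f (u φ)
  map_one' := rfl
  map_mul' _ _ := rfl
  map_zero' := rfl
  map_add' _ _ := rfl

/-- `(fieldPrecomp u f)(φ) = f(u φ)`. [folklore] -/
@[simp] theorem fieldPrecomp_apply (u : (Λ → ℂ) → (Λ → ℂ)) (f : FieldFun Λ) (φ : Λ → ℂ) :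
    fieldPrecomp u f φ = f (u φ) := rfl

/-- Constants are fixed by every substitution. [folklore] -/
theorem fieldPrecomp_constFun (u : (Λ → ℂ) → (Λ → ℂ)) (z : ℂ) :
    fieldPrecomp u (constFun z) = (constFun z : FieldFun Λ) := rfl

/-- **Complex scalars act on forms through the constant `0`-forms**: `z • K = (z·1) K`. [folklore] -/
theorem smul_eq_ofFun_mul (z : ℂ) (K : SForm Λ) : z • K = ofFun (constFun z) * K := by
  rw [ofFun, Algebra.smul_def]; rfl

/-- `(c • φ)_x = c φ_x` for a real scalar. [folklore] -/
theorem real_smul_apply (c : ℝ) (φ : Λ → ℂ) (x : Λ) : (c • φ) x = (c : ℂ) * φ x := by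
  rw [Pi.smul_apply, Complex.real_smul]

variable [Fintype Λ] [LinearOrder Λ]

/-- **Substitution in the boson field**, `F(φ, ψ) ↦ F(u(φ), ψ)`: the change of coefficients of the form
algebra along `f ↦ f ∘ u` (a ring endomorphism of `𝒩`; the fermionic generators are untouched).
[cite: BauerschmidtBrydgesSlade2015LogCorr, §4.1 ("writing F'(φ,ψ) = F(φ',ψ')"; "the translation φ ↦ φ + CJ … leaves ψ unchanged")] -/
def substForm (u : (Λ → ℂ) → (Λ → ℂ)) : SForm Λ →+* SForm Λ := coeffMap (fieldPrecomp u)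

/-- Substitution on `0`-forms: `f(φ) ↦ f(u φ)`. [folklore] -/
theorem substForm_ofFun (u : (Λ → ℂ) → (Λ → ℂ)) (f : FieldFun Λ) :
    substForm u (ofFun f) = ofFun (fun φ => f (u φ)) := by
  rw [substForm, ofFun, ofFun, GrassmannAlgebra.coeffMap_algebraMap]; rfl

/-- Substitution is semilinear over the `0`-forms. [folklore] -/
theorem substForm_smul (u : (Λ → ℂ) → (Λ → ℂ)) (f : FieldFun Λ) (K : SForm Λ) :
    substForm u (f • K) = fieldPrecomp u f • substForm u K :=
  GrassmannAlgebra.coeffMap_smul _ f K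

/-- Substitution is linear over `ℂ`. [folklore] -/
theorem substForm_complex_smul (u : (Λ → ℂ) → (Λ → ℂ)) (z : ℂ) (K : SForm Λ) :
    substForm u (z • K) = z • substForm u K := by
  rw [smul_eq_ofFun_mul, smul_eq_ofFun_mul, map_mul, substForm_ofFun]; rfl

/-- Substitution fixes `ψ_x`. [folklore] -/
theorem substForm_psi (u : (Λ → ℂ) → (Λ → ℂ)) (x : Λ) :
    substForm u (psi (FieldFun Λ) x) = psi (FieldFun Λ) x := by
  unfold substForm psi; exact GrassmannAlgebra.coeffMap_gen _ _

/-- Substitution fixes `ψ̄_x`. [folklore] -/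
theorem substForm_psiBar (u : (Λ → ℂ) → (Λ → ℂ)) (x : Λ) :
    substForm u (psiBar (FieldFun Λ) x) = psiBar (FieldFun Λ) x := by
  unfold substForm psiBar; exact GrassmannAlgebra.coeffMap_gen _ _

/-- **Top coefficient of a substituted form**: `[F(u φ, ψ)]_{top}(φ) = [F]_{top}(u φ)`. [folklore] -/
theorem berezin_substForm_apply (u : (Λ → ℂ) → (Λ → ℂ)) (K : SForm Λ) (φ : Λ → ℂ) :
    berezin (FieldFun Λ) (Λ ⊕ₗ Λ) (substForm u K) φ = berezin (FieldFun Λ) (Λ ⊕ₗ Λ) K (u φ) := by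
  rw [substForm, GrassmannAlgebra.berezin_coeffMap]; rfl

/-- Substitution commutes with the exponential of nilpotent forms. [folklore] -/
theorem substForm_grassmannExp (u : (Λ → ℂ) → (Λ → ℂ)) {a : SForm Λ} (ha : IsNilpotent a) :
    substForm u (grassmannExp a) = grassmannExp (substForm u a) :=
  GrassmannAlgebra.coeffMap_grassmannExp _ ha

/-- **Translation invariance of the super-integral**: `∫ F(h + φ, ψ) = ∫ F(φ, ψ)` (translation
invariance of Lebesgue measure on `ℂ^Λ`; the fermionic variables are not moved).
[cite: BauerschmidtBrydgesSlade2015LogCorr, §4.1 ("(4.20) follows with the translation φ ↦ φ + CJ of the integration variable … This translation of φ leaves ψ = (2πi)^{-1/2}dφ unchanged")] -/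
theorem superIntegral_substForm_const_add (h : Λ → ℂ) (K : SForm Λ) :
    superIntegral (substForm (fun φ => h + φ) K) = superIntegral K := by
  unfold superIntegral
  congr 1
  simp_rw [berezin_substForm_apply]
  exact integral_add_left_eq_self _ h

end Subst

end CTWSAW

end Literature.Barriers.CriticalPhenomena
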